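import Summits.Langlands.Langlands.Theses.SkinnerWilesDefectOne
import Literature.NumberTheory.Automorphic.BianchiOrdinaryClassicality
import Literature.NumberTheory.GaloisRepresentations.LAdicRepFrobenius
import Literature.NumberTheory.Automorphic.ChebotarevArtinRepHolds
import Literature.RepresentationTheory.Semisimple.SubrepresentationEquiv

/-!
# Route `SkinnerWilesDefectOne`, crux `ProModularOrdinaryClassical` (stmt-Langlands-12921), line
# `top-degree-exact-control`: stub 3 `stub_dominantPointsClassical` modulo three named facts

Stub 3 of the checked skeleton (lead rev 2): a continuous `ℚ̄_p`-point `x` of Hida's ordinary big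
Hecke algebra `𝕋^{S,ord}(𝒰)` (`OrdinaryHeckeAlgebraGLn`) of `GL₂` over an imaginary quadratic field
`F`, associated with an IRREDUCIBLE `ρ` and of DOMINANT diamond weight `k ≥ 2`, is the eigensystem
of a regular algebraic cuspidal `π₀` on `GL₂(𝔸_F)` (Satake parameters in the `HasSatakeParamAt`
normalisation at almost all `w`).  Proved here as `stub_dominantPointsClassical_of_facts`: the
registered signature VERBATIM except that (i) the three printed inputs, vendored as the named facts
of `Literature/NumberTheory/Automorphic/BianchiOrdinaryClassicality.lean`, are prepended as
hypotheses, and (ii) the dominant-weight hypothesis is the Literature predicate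
`TameLevel.HasDominantDiamondWeight 𝒰 x k`, DEFINITIONALLY EQUAL (same body) to the line's
interface predicate `HasDominantDiamondWeight 𝒰 x k` of the lead's
`Theorems/SkinnerWilesDefectOneProModularOrdinaryClassicalDefs.lean`, and the re-registered stub
(rev 3, facts prepended) `stub_dominantPointsClassical` is restated verbatim at the end of this file and closed by it.

1. `hidaControl_dominantOrdinaryPoint` (Hida 1994 Thm. 2.2/3.2; Khare–Thorne 2017 §6.4–6.5):
   `x` occurs on a non-zero class `ξ ∈ H^q(X_U, Ṽ_{(k−2,0)}(ℚ̄_p))` at some open compact level `U`,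
   `T_{w,j} ξ = x(T_{w,j}) ξ` for almost all `w`;
2. `bianchi_interiorEigenclass_isCuspidal` (Harder 1987; Franke Thm. 18): if `ξ` is interior it is
   the eigenclass of a cuspidal `π₀` of infinity type `cohomologicalInfinityType 2 F (0, 2−k)`,
   hence regular algebraic (`isRegularAlgebraic_of_hasInfinityType_cohomological`), with the Satake
   identities verbatim;
3. `bianchi_boundaryEigensystem_isReducible` (Harder 1987 + Weil/Serre): if `ξ` is NOT interior,
   a semisimple reducible `σ : Γ_F → GL₂(ℚ̄_p)` has `charpoly σ(Frob_w) = X² − x(T_{w,1})X +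
   q_w x(T_{w,2})` a.e. — the same polynomials as `ρ` (`IsOrdAssociated`), so `ρ ≃ σ` by
   Chebotarev + Brauer–Nesbitt (tree theorem
   `FramedGaloisRep.nonempty_equiv_of_hasFrobCharpolyAt_eventually`, with the DISCHARGED
   `chebotarev_artinRep_holds`; `ρ` irreducible ⟹ semisimple), contradicting the irreducibility
   of `ρ` (`Representation.isIrreducible_of_equiv`).

The hypotheses `p ≠ 2`, `0 < m` and Galois-ordinarity of `ρ` are carried (registered signature)
but not used by this Hecke-side argument.
-/

namespace Summit.Langlands.Langlands.Cruxes.ProModularOrdinaryClassical.TopDegreeExactControl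

set_option linter.dupNamespace false

open Literature.NumberTheory.Automorphic Literature.NumberTheory.Automorphic.BigHeckeGLn
open Literature.NumberTheory.GaloisRepresentations
open NumberField IsDedekindDomain Filter

/-- An irreducible continuous Galois representation over a field is semisimple (a simple lattice
of subrepresentations is complemented). [folklore] -/
theorem isSemisimple_of_isIrreducible {F : Type} [Field F] [NumberField F] {A : Type*} [Field A]
    [TopologicalSpace A] [IsTopologicalRing A] {n : ℕ} (ρ : FramedGaloisRep F A n)
    (h : ρ.toGaloisRep.IsIrreducible) : ρ.toGaloisRep.IsSemisimple := by
  haveI : ρ.toGaloisRep.toRepresentation.IsIrreducible := h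
  change ComplementedLattice _
  infer_instance

/-- **Stub 3 modulo the named facts** (registered signature of `stub_dominantPointsClassical` with
the three facts of `BianchiOrdinaryClassicality` prepended and the dominant-weight hypothesis
spelled as the definitionally equal Literature predicate): dominant ordinary `ℚ̄_p`-points
associated with an irreducible `ρ` are classical — Hida control puts `x` on an a.e.-eigenclass `ξ`
in weight-`(k−2,0)` cohomology of some open compact level; if `ξ` is interior, Harder/Franke give
the cuspidal regular algebraic `π₀` with the Satake identities; if not, the boundary eigensystem
has a semisimple reducible Galois representation with the same Frobenius polynomials as `ρ`,
which Chebotarev + Brauer–Nesbitt identify with `ρ`, contradicting irreducibility. [folklore] -/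
theorem stub_dominantPointsClassical_of_facts
    (hA : hidaControl_dominantOrdinaryPoint)
    (hB : bianchi_interiorEigenclass_isCuspidal)
    (hC : bianchi_boundaryEigensystem_isReducible) :
    ∀ (F : Type) [Field F] [NumberField F], NumberField.IsTotallyComplex F → Module.finrank ℚ F = 2 → ∀ (p : ℕ) [Fact p.Prime], p ≠ 2 → ∀ (hcpt : Literature.NumberTheory.Automorphic.isCompact_glFiniteIntegralLevel 2 F) (ι : PadicAlgCl p ≃+* ℂ) (ρ : Literature.NumberTheory.GaloisRepresentations.FramedGaloisRep F (PadicAlgCl p) 2) (𝒰 : Literature.NumberTheory.Automorphic.BigHeckeGLn.TameLevel 2 F p) (x : Literature.NumberTheory.Automorphic.OrdinaryHeckeAlgebraGLn 𝒰 →+* PadicAlgCl p) (k m : ℕ), ρ.toGaloisRep.IsIrreducible → 𝒰.IsMaximalAbove → Continuous x → 𝒰.IsOrdAssociated x ρ → 2 ≤ k → 0 < m → (∀ v : IsDedekindDomain.HeightOneSpectrum (NumberField.RingOfIntegers F), (p : NumberField.RingOfIntegers F) ∈ v.asIdeal → ρ.IsOrdinaryOfWeightAt p v k m) → 𝒰.HasDominantDiamondWeight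 x k → ∃ π₀ : Literature.NumberTheory.Automorphic.CuspidalAutomorphicRepData 2 F hcpt, π₀.1.IsRegularAlgebraic ∧ ∀ᶠ w : IsDedekindDomain.HeightOneSpectrum (NumberField.RingOfIntegers F) in Filter.cofinite, ∃ α : Multiset ℂ, π₀.1.HasSatakeParamAt w α ∧ ι (x (𝒰.ordT w 1)) = ((Real.sqrt (w.residueCard : ℝ) : ℝ) : ℂ) * α.esymm 1 ∧ ι (x (𝒰.ordT w 2)) = α.esymm 2 := by
  intro F _ _ hF hdeg p _ hp hcpt ι ρ 𝒰 x k m hirr h𝒰 hx hass hk hm hv hdom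
  -- (1) Hida control: `x` occurs on a class `ξ ≠ 0` in `H^q(X_U, Ṽ_{(k-2,0)}(ℚ̄_p))`
  obtain ⟨U, hUo, hUc, q, ξ, hξ0, hξ⟩ := hA F hF hdeg p 𝒰 x k h𝒰 hx hk hdom
  set a : HeightOneSpectrum (𝓞 F) → ℕ → PadicAlgCl p := fun w j => x (𝒰.ordT w j) with ha
  have heig : ∀ᶠ w in cofinite,
      ParallelWeight.heckeT (PadicAlgCl p) F 2 (symWeight k) U q w 1 ξ = a w 1 • ξ ∧
        ParallelWeight.heckeT (PadicAlgCl p) F 2 (symWeight k) U q w 2 ξ = a w 2 • ξ :=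
    hξ.mono fun w hw => ⟨hw 1, hw 2⟩
  by_cases hint : ξ ∈ ParallelWeight.interiorCohomology (PadicAlgCl p) F 2 (symWeight k) U q
  · -- (2) interior: Eichler–Shimura–Harder
    obtain ⟨π₀, hinf, hsat⟩ := hB F hF hdeg hcpt (PadicAlgCl p) ι (symWeight k)
      (isDominant_symWeight hk) U hUo hUc q ξ hint hξ0 a heig
    exact ⟨π₀, Literature.Barriers.Langlands.isRegularAlgebraic_of_hasInfinityType_cohomological
      (isDominant_dual_symWeight hk) hinf, hsat⟩
  · -- (3) boundary: reducible Galois representation with the Frobenius polynomials of `ρ`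
    exfalso
    obtain ⟨σ, hσss, hσred, hσ⟩ := hC F hF hdeg p (symWeight k) (isDominant_symWeight hk)
      U hUo hUc q ξ hint a heig
    have hboth : ∀ᶠ v : HeightOneSpectrum (𝓞 F) in cofinite,
        ρ.IsUnramifiedAt v ∧ σ.IsUnramifiedAt v ∧
          ∃ P : Polynomial (PadicAlgCl p), ρ.HasFrobCharpolyAt v P ∧ σ.HasFrobCharpolyAt v P := by
      filter_upwards [Set.Finite.eventually_cofinite_notMem 𝒰.bad_finite, hσ] with v hv hσv
      exact ⟨(hass v hv).1, hσv.1, _, (hass v hv).2, hσv.2⟩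
    obtain ⟨e⟩ := FramedGaloisRep.nonempty_equiv_of_hasFrobCharpolyAt_eventually
      chebotarev_artinRep_holds ρ σ (isSemisimple_of_isIrreducible ρ hirr) hσss hboth
    haveI : ρ.toGaloisRep.toRepresentation.IsIrreducible := hirr
    exact hσred
      (Literature.RepresentationTheory.Semisimple.Representation.isIrreducible_of_equiv e.toRepEquiv)

/-- **Registered stub `stub_dominantPointsClassical`** (line `top-degree-exact-control`, skeleton rev 3; signature
verbatim: the three named facts of `BianchiOrdinaryClassicality` prepended to the Hecke-side statement) — from
`stub_dominantPointsClassical_of_facts`. [folklore] -/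
theorem stub_dominantPointsClassical : Literature.NumberTheory.Automorphic.hidaControl_dominantOrdinaryPoint → Literature.NumberTheory.Automorphic.bianchi_interiorEigenclass_isCuspidal → Literature.NumberTheory.Automorphic.bianchi_boundaryEigensystem_isReducible → ∀ (F : Type) [Field F] [NumberField F], NumberField.IsTotallyComplex F → Module.finrank ℚ F = 2 → ∀ (p : ℕ) [Fact p.Prime], p ≠ 2 → ∀ (hcpt : Literature.NumberTheory.Automorphic.isCompact_glFiniteIntegralLevel 2 F) (ι : PadicAlgCl p ≃+* ℂ) (ρ : Literature.NumberTheory.GaloisRepresentations.FramedGaloisRep F (PadicAlgCl p) 2) (𝒰 : Literature.NumberTheory.Automorphic.BigHeckeGLn.TameLevel 2 F p) (x : Literature.NumberTheory.Automorphic.OrdinaryHeckeAlgebraGLn 𝒰 →+* PadicAlgCl p) (k m : ℕ), ρ.toGaloisRep.IsIrreducible → 𝒰.IsMaximalAbove → Continuous x → 𝒰.IsOrdAssociated x ρ → 2 ≤ k → 0 < m → (∀ v : IsDedekindDomain.HeightOneSpectrum (NumberField.RingOfIntegers F), (p : NumberField.RingOfIntegers F) ∈ v.asIdeal → ρ.IsOrdinaryOfWeightAt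 p v k m) → 𝒰.HasDominantDiamondWeight x k → ∃ π₀ : Literature.NumberTheory.Automorphic.CuspidalAutomorphicRepData 2 F hcpt, π₀.1.IsRegularAlgebraic ∧ ∀ᶠ w : IsDedekindDomain.HeightOneSpectrum (NumberField.RingOfIntegers F) in Filter.cofinite, ∃ α : Multiset ℂ, π₀.1.HasSatakeParamAt w α ∧ ι (x (𝒰.ordT w 1)) = ((Real.sqrt (w.residueCard : ℝ) : ℝ) : ℂ) * α.esymm 1 ∧ ι (x (𝒰.ordT w 2)) = α.esymm 2 :=
  fun hA hB hC => stub_dominantPointsClassical_of_facts hA hB hC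

end Summit.Langlands.Langlands.Cruxes.ProModularOrdinaryClassical.TopDegreeExactControl
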